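import Summits.ABC.IUTFork.Cor312LicenceShallowConcreteDatumSqrtNegOne
import Summits.ABC.IUTFork.Cor312LicenceShallowRealising
import Summits.ABC.IUTFork.Cor312PilotIdelesPrCapstone
import HarnessLib

/-!
# [IUTchIII] Cor. 3.12 — the concrete inhabited-side pilot datum WITH `√−1` in the base field ([IUTchI] Def. 3.1 (a)), part 2:
# at `X75i = (ℚ(⁵√7, √−1), 7⁻², V₇, 5)` the (xi-f) licence, branch C's antecedent and the typed Statement hold for realising ideles

PROOF-ONLY record file (D-0012; 0 definitions, 0 `Prop` facts; theorems only) of the abc-iut cell (block C / W6 cone prover abc-iut-w6-d114,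
gen 4; row «LICENCE-SHALLOW-CONCRETE-DATUM-SQRT-NEG-ONE», sequel of the definition-bearing part 1
`Cor312LicenceShallowConcreteDatumSqrtNegOne`; the `√−1`-variant of this seat's `Cor312LicenceShallowConcreteDatumLicence` (p442096),
answering the RQ7 note of abc-iut-w6-d091 (HOME/STATUS 2026-08-26T11:43:14Z) that `ℚ(⁵√7) ⊂ ℝ` violates [IUTchI] Def. 3.1 (a)).
TAKES NO SIDE on [IUTchIII] Cor. 3.12 or on any author: every statement is about OUR typed objects — abc-iut-c312-7's
print-normalised sharp real setting `Real.settingPrVolSharp` / abc-iut-c312-3's `Real.settingDHVolSharp` over abc-iut-c312-5's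
Dupuy–Hilado-level real log-shells, sharp Θ-boxes and `q`-centres read off ideles REALISING `P_Θ`, `P_q` (Dupuy–Hilado (3.4)),
Dupuy–Hilado's typed (Ind1)/(Ind2).

Part 1 built `X75i` over `F75i = ℚ(⁵√7, √−1)` (`√−1 ∈ F75i`; one place over `7`, `e = 5`, `f = 2`, tame; `j_E = 7⁻²`, `l = 5`,
`P_q(v) = 1`) and discharged the two arithmetic binders `htame`, `hdeg` of abc-iut-w5-d236's
`exists_qPinned_and_hull_settingPrVolSharp_of_realises_shallow` (p439445). THIS FILE first finishes part 1's place arithmetic (§3b: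
`n_v = 10`, hence `[F75i : ℚ] = 10` and exactly ONE place over `7`; `deĝ(P_q) = 2 ln 7`, `deĝ̲(P_q) = (ln 7)/5`) and then composes,
exactly as p442096 did for `X75`:

* §4 **`licence_settingPrVolSharp_concreteDatumSqrtNegOne`** / `…settingDHVolSharp…`,
  **`exists_qPinned_and_hull_settingPrVolSharp_concreteDatumSqrtNegOne`** — at `X75i`, for EVERY family of realising ideles and every
  structural binder of the sharp setting, the (xi-f) `Licence` and branch C's «`∃ ρ qK, QPinned ∧ PilotKummerCompatHull`» hold, with NO
  arithmetic hypothesis left; hence (abc-iut-c312-1's `statement_of_licence` + abc-iut-c312-7's `bridgeHyps_settingPrVolSharp_of_ideles` /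
  `statement_settingPrVolSharp_iff`) **`statement_settingPrVolSharp_concreteDatumSqrtNegOne`** — the typed `Statement` of Cor. 3.12 at that
  setting — and the Θ-side inequality **`thetaSide_settingPrVolSharp_concreteDatumSqrtNegOne(_explicit)`**: `−(ln 7)/5 ≤ −|log Θ|`.
* §5 **`exists_realising_ideles_licence_concreteDatumSqrtNegOne`** — packaged NON-VACUITY: with the analytic logarithms `analyticLogv F75i`
  there EXIST realising ideles `t_q`, `t_Θ` (non-zero, units off `S`; abc-iut-c312-3 / `Cor312Prov.exists_realising_…`) such that,
  for every structural binder, the `Licence` and the typed `Statement` hold and branch C's antecedent is inhabited at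
  `settingPrVolSharp X75i …`.

READING (neutral; numbers, not adjectives). The inhabited-side concrete datum now lives over a base field satisfying [IUTchI] Def. 3.1
(a)'s `√−1 ∈ F`; it remains a PilotData-level inhabitant (no elliptic curve, no `K = F(E[l])`; K-level / initial-Θ-data genuineness,
abc-iut-C-cert-3 v5K, is NOT claimed). The typed `Statement` at ONE shallow point (`|log(q)| = (ln 7)/5`) carries no Diophantine content.
HONEST SCOPE as in the parents: OUR typed sharp containers and Dupuy–Hilado's typed (Ind2); the licence is a STRONGER-THAN-PRINT
set-level form; nothing about the printed GLOBAL inequality; nothing asserts or refutes [IUTchIII] Cor. 3.12.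
[cite: DupuyHilado2025, §3.3, §3.4, §3.9, §4.9] [cite: Mochizuki2012, IUTchI Def. 3.1 (a) p. 67, Ex. 3.2 (iv) p. 71]
[claim: Mochizuki2012, status: disputed] for every IUT sentence quoted. typed ≠ proved; instantiated ≠ endorsed.
-/

noncomputable section

/-! ## §3b. One place over `7`, `[F75i : ℚ] = 10`, and the degree of `P_q` (part 1's facts, continued) -/

namespace Summit.ABC.IUTFork.ConcreteDatumSqrtNegOne

open NumberField IsDedekindDomain
open Literature.IUT.LogVolume

/-- `n_v = 10` at every place over `7`. [cite: NeukirchANT1999, Ch. I §8 Prop. (8.2)] -/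
theorem localDegree_of_mem_placesOver {v : HeightOneSpectrum (𝓞 ↥F75i)} (hv : v ∈ placesOver ↥F75i 7) :
    localDegree ↥F75i v = 10 := by
  unfold localDegree
  rw [ramIdx_of_mem_placesOver hv, resDeg_of_mem_placesOver hv]

/-- **`[F75i : ℚ] = 10`** (`≥` from one place over `7` with `n_v = 10`, `≤` from the compositum bound). [folklore] -/
theorem finrank_F75i : Module.finrank ℚ ↥F75i = 10 := by
  obtain ⟨v, hv⟩ := placesOver_nonempty ↥F75i 7
  have hle : localDegree ↥F75i v ≤ ∑ w ∈ placesOver ↥F75i 7, localDegree ↥F75i w :=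
    Finset.single_le_sum (fun w _ => Nat.zero_le (localDegree ↥F75i w)) hv
  rw [sum_localDegree, localDegree_of_mem_placesOver hv] at hle
  exact le_antisymm finrank_F75i_le hle

/-- **There is exactly ONE place of `ℚ(⁵√7, √−1)` over `7`.** [folklore] -/
theorem card_placesOver_seven : (placesOver ↥F75i 7).card = 1 := by
  have hsum : ∑ w ∈ placesOver ↥F75i 7, localDegree ↥F75i w = 10 := by
    rw [sum_localDegree, finrank_F75i]
  have hle : (placesOver ↥F75i 7).card • 10 ≤ ∑ w ∈ placesOver ↥F75i 7, localDegree ↥F75i w :=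
    Finset.card_nsmul_le_sum _ _ _ fun w hw => (localDegree_of_mem_placesOver hw).ge
  have hpos : 0 < (placesOver ↥F75i 7).card := Finset.card_pos.mpr (placesOver_nonempty ↥F75i 7)
  rw [hsum, smul_eq_mul] at hle
  omega

/-- `ln|κ(v)| = 2 ln 7` at a place over `7` (`f_v = 2`). [cite: DupuyHilado2025, §2.5.4] -/
theorem logNorm_of_mem_placesOver {v : HeightOneSpectrum (𝓞 ↥F75i)} (hv : v ∈ placesOver ↥F75i 7) :
    logNorm ↥F75i v = 2 * Real.log 7 := by
  rw [logNorm_eq, resDeg_of_mem_placesOver hv, residueChar_of_mem_placesOver hv]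
  push_cast
  ring

/-- **`deĝ(P_q) = 2 ln 7`** for `X75i` (one place with `ln|κ(v)| = 2 ln 7`). [cite: DupuyHilado2025, §2.5.4, §3.3] -/
theorem deg_qPilot_X75i : FinDivisor.deg ↥F75i X75i.qPilot = 2 * Real.log 7 := by
  rw [PilotData.qPilot, FinDivisor.deg_sum_of]
  have h : ∀ v ∈ X75i.S, (X75i.ordq v : ℝ) / (2 * X75i.l) * logNorm ↥F75i v = 2 * Real.log 7 := by
    intro v hv
    rw [X75i_ordq hv, X75i_l, logNorm_of_mem_placesOver hv]
    norm_num
  rw [Finset.sum_congr rfl h, Finset.sum_const, X75i_S, card_placesOver_seven]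
  simp

/-- **`deĝ̲(P_q) = |log(q)| = (ln 7)/5`** for `X75i` (`[F75i : ℚ] = 10`; unchanged from `X75`). [cite: DupuyHilado2025, §2.5.4, §3.3] -/
theorem ndeg_qPilot_X75i : FinDivisor.ndeg ↥F75i X75i.qPilot = Real.log 7 / 5 := by
  rw [FinDivisor.ndeg_apply, deg_qPilot_X75i, finrank_F75i]
  ring

end Summit.ABC.IUTFork.ConcreteDatumSqrtNegOne


/-! ## §4. The licence, branch C's antecedent, the typed Statement and the Θ-side at `X75i`, for every family of realising ideles -/

namespace Summit.ABC.IUTFork.Thm311.Real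

open Set Metric Function NumberField IsDedekindDomain
open Cor312 Cor312.Setting Cor312Vol Literature.IUT.LogThetaLattice Literature.IUT.LogVolume
open Literature.NumberTheory.NumberFields Literature.NumberTheory.GaloisRepresentations.Ultrametric
open Summit.ABC.IUTFork.ConcreteDatumSqrtNegOne

variable {logv : PadicLogs ↥F75i} (hlog : LogvAnalytic logv)
  (M : Type) [Field M] [NumberField M]
  (archPk : ∀ (j : (thetaIndex X75i).Label) (vQ : (thetaIndex X75i).VQ), Set ((logShellsDH X75i logv).Packet j vQ))
  (archSub : ∀ (j : (thetaIndex X75i).Label) (v : (thetaIndex X75i).V),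
    Set ((logShellsDH X75i logv).Packet j ((thetaIndex X75i).over v)))
  (Ψ : ℤ → ∀ v : (thetaIndex X75i).V, v ∈ (thetaIndex X75i).Vbad → Set ((logShellsDH X75i logv).StarPacket v))
  (act : ℤ → ∀ v : (thetaIndex X75i).V, v ∈ (thetaIndex X75i).Vbad →
    (logShellsDH X75i logv).StarPacket v → Module.End ℚ ((logShellsDH X75i logv).StarPacket v))
  (Mmod : ℤ → ∀ j : (thetaIndex X75i).LabelStar, Set ((logShellsDH X75i logv).GlobalPacket j.1))
  (region : ℤ → ∀ j : (thetaIndex X75i).LabelStar, FinDivisor M → ∀ vQ : (thetaIndex X75i).VQ,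
    Set ((logShellsDH X75i logv).Packet j.1 vQ))
  (n : ℤ) {HT : Type} {LogLink : HT → HT → Type} {IsFull : ∀ {s t : HT}, LogLink s t → Prop}
  (lat : LGPGaussianLogThetaLattice LogLink IsFull)
  {Frd : Type} {IsoF : Frd → Frd → Type} {Ob : Frd → Type} {realify : Frd → Frd} {Strip : Type}
  {IsoS : Strip → Strip → Type} {Mv : ∀ v : (thetaIndex X75i).V, v ∈ (thetaIndex X75i).Vbad → Type}
  [∀ v h, Monoid (Mv v h)]
  (sig : GlobalLGPFrobenioidSignature (thetaIndex X75i).lstar (thetaIndex X75i).V (· ∈ (thetaIndex X75i).Vbad)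
    Frd IsoF Ob realify Strip IsoS Mv)
  (split : SplittingMonoids Mv) {ObΔ : Type} {N : ∀ v : (thetaIndex X75i).V, v ∈ (thetaIndex X75i).Vbad → Type}
  [∀ v h, Monoid (N v h)] (qData : QPilotData ObΔ N)
  (tq : ∀ (pp : Nat.Primes) (x : (thetaIndex X75i).Fibre (.inr pp)), haveI : Fact (pp : ℕ).Prime := ⟨pp.2⟩; kOf X75i pp.1 x)
  (t : ∀ (pp : Nat.Primes) (_ : Fin X75i.lstar) (x : (thetaIndex X75i).Fibre (.inr pp)),
    haveI : Fact (pp : ℕ).Prime := ⟨pp.2⟩; kOf X75i pp.1 x)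
  (htq0 : ∀ pp x, tq pp x ≠ 0)
  (htq1 : ∀ (pp : Nat.Primes) (x : (thetaIndex X75i).Fibre (.inr pp)),
    haveI : Fact (pp : ℕ).Prime := ⟨pp.2⟩; placeOf X75i pp.1 x ∉ X75i.S → ‖tq pp x‖ = 1)
  (col : ℤ → Column (logShellsDH X75i logv))
  (ht0 : ∀ pp i x, t pp i x ≠ 0)
  (ht : ∀ (pp : Nat.Primes) (i : Fin X75i.lstar) (x : (thetaIndex X75i).Fibre (.inr pp)),
    haveI : Fact (pp : ℕ).Prime := ⟨pp.2⟩
    Real.log ‖t pp i x‖ = -(X75i.thetaPilot i (placeOf X75i pp.1 x)) * logNorm ↥F75i (placeOf X75i pp.1 x) /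
      localDegree ↥F75i (placeOf X75i pp.1 x))
  (htq : ∀ (pp : Nat.Primes) (x : (thetaIndex X75i).Fibre (.inr pp)),
    haveI : Fact (pp : ℕ).Prime := ⟨pp.2⟩
    Real.log ‖tq pp x‖ = -(X75i.qPilot (placeOf X75i pp.1 x)) * logNorm ↥F75i (placeOf X75i pp.1 x) /
      localDegree ↥F75i (placeOf X75i pp.1 x))

include ht0 ht htq in
/-- **THE (xi-f) LICENCE AT `settingDHVolSharp X75i …` FOR EVERY FAMILY OF REALISING IDELES — no arithmetic hypothesis**
(abc-iut-w5-d236's `licence_settingDHVolSharp_of_realises_shallow` with `htame`, `hdeg` discharged by §2–§3).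
[cite: DupuyHilado2025, §3.4, §3.9, §4.9] [claim: Mochizuki2012, status: disputed] -/
theorem licence_settingDHVolSharp_concreteDatumSqrtNegOne :
    Thm311ToCor312.Licence (settingDHVolSharp X75i hlog M archPk archSub Ψ act Mmod region n lat sig split qData tq t htq0 htq1) :=
  licence_settingDHVolSharp_of_realises_shallow X75i hlog M archPk archSub Ψ act Mmod region n lat sig split qData tq t htq0 htq1
    ht0 ht htq htame_X75i hdeg_X75i

include ht0 ht htq in
/-- **THE (xi-f) LICENCE AT THE PRINT-NORMALISED SHARP SETTING `settingPrVolSharp X75i …` FOR EVERY FAMILY OF REALISING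
IDELES — no arithmetic hypothesis.** [cite: DupuyHilado2025, §3.4, §3.9, §4.9] [claim: Mochizuki2012, status: disputed] -/
theorem licence_settingPrVolSharp_concreteDatumSqrtNegOne :
    Thm311ToCor312.Licence (settingPrVolSharp X75i hlog M archPk archSub Ψ act Mmod region n lat sig split qData tq t htq0 htq1) :=
  licence_settingPrVolSharp_of_realises_shallow X75i hlog M archPk archSub Ψ act Mmod region n lat sig split qData tq t htq0 htq1
    ht0 ht htq htame_X75i hdeg_X75i

include ht0 ht htq in
/-- **BRANCH C's ANTECEDENT «`∃ ρ qK, QPinned ∧ PilotKummerCompatHull`» IS INHABITED at `settingPrVolSharp X75i …` for every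
family of realising ideles and every column structure — no arithmetic hypothesis.** With abc-iut-C-cert-1's
`thetaSide_of_exists_qPinned_and_hull_settingPrVolSharp` the typed Θ-side inequality follows there.
[cite: DupuyHilado2025, §3.4, §3.9, §4.9] [claim: Mochizuki2012, status: disputed] -/
theorem exists_qPinned_and_hull_settingPrVolSharp_concreteDatumSqrtNegOne :
    ∃ (ρ : (∀ v : (thetaIndex X75i).V, v ∈ (thetaIndex X75i).Vbad → Set ((logShellsDH X75i logv).StarPacket v)) →
          ∀ (j : (thetaIndex X75i).Label) (vQ : (thetaIndex X75i).VQ), Set ((logShellsDH X75i logv).Packet j vQ))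
        (qK : ∀ v : (thetaIndex X75i).V, v ∈ (thetaIndex X75i).Vbad → Set ((logShellsDH X75i logv).StarPacket v)),
        QPinned ({ toSituation := situationPrVol X75i hlog M archPk archSub Ψ act Mmod region, col := col } :
            LatticeSituation (thetaIndex X75i))
          (settingPrVolSharp X75i hlog M archPk archSub Ψ act Mmod region n lat sig split qData tq t htq0 htq1) ρ qK ∧
        PilotKummerCompatHull ({ toSituation := situationPrVol X75i hlog M archPk archSub Ψ act Mmod region, col := col } :
            LatticeSituation (thetaIndex X75i))
          (settingPrVolSharp X75i hlog M archPk archSub Ψ act Mmod region n lat sig split qData tq t htq0 htq1) ρ qK :=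
  exists_qPinned_and_hull_settingPrVolSharp_of_realises_shallow X75i hlog M archPk archSub Ψ act Mmod region n lat sig split
    qData tq t htq0 htq1 col ht0 ht htq htame_X75i hdeg_X75i

include ht0 ht htq in
/-- **THE TYPED `Statement` OF [IUTchIII] COR. 3.12 AT `settingPrVolSharp X75i …` FOR EVERY FAMILY OF REALISING IDELES**
(abc-iut-c312-1's `Thm311ToCor312.statement_of_licence`: `BridgeHyps` — abc-iut-c312-7's `bridgeHyps_settingPrVolSharp_of_ideles`,
Θ-ideles units off `S` by `norm_eq_one_of_realises` — plus §4's licence). HONEST READING: one PilotData-level point with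
`|log(q)| = (ln 7)/5` in the sharp Dupuy–Hilado reading; no Diophantine content, nothing about the printed corollary in general.
[cite: DupuyHilado2025, §3.4, §3.9, §4.9] [claim: Mochizuki2012, status: disputed] -/
theorem statement_settingPrVolSharp_concreteDatumSqrtNegOne :
    (settingPrVolSharp X75i hlog M archPk archSub Ψ act Mmod region n lat sig split qData tq t htq0 htq1).Statement :=
  Thm311ToCor312.statement_of_licence
    (bridgeHyps_settingPrVolSharp_of_ideles X75i hlog M archPk archSub Ψ act Mmod region n lat sig split qData t tq ht0
      (fun pp i x hx => norm_eq_one_of_realises X75i t ht0 ht pp i x hx) htq0 htq1)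
    (licence_settingPrVolSharp_concreteDatumSqrtNegOne hlog M archPk archSub Ψ act Mmod region n lat sig split qData tq t htq0 htq1 ht0 ht htq)

include ht0 ht htq in
/-- **THE TYPED Θ-SIDE INEQUALITY OF COR. 3.12 AT THE CONCRETE DATUM**, `↑(−deĝ̲(P_q)) ≤ −|log Θ|` at `settingPrVolSharp X75i …`,
for every family of realising ideles and every structural binder (abc-iut-c312-7's `statement_settingPrVolSharp_iff`).
[cite: DupuyHilado2025, §3.4, §3.9, §4.9] [claim: Mochizuki2012, status: disputed] -/
theorem thetaSide_settingPrVolSharp_concreteDatumSqrtNegOne :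
    (((-FinDivisor.ndeg ↥F75i X75i.qPilot : ℝ)) : WithTop ℝ) ≤
      (settingPrVolSharp X75i hlog M archPk archSub Ψ act Mmod region n lat sig split qData tq t htq0 htq1).negLogTheta :=
  (statement_settingPrVolSharp_iff X75i hlog M archPk archSub Ψ act Mmod region n lat sig split qData t tq ht0
      (fun pp i x hx => norm_eq_one_of_realises X75i t ht0 ht pp i x hx) htq0 htq1 htq).1
    (statement_settingPrVolSharp_concreteDatumSqrtNegOne hlog M archPk archSub Ψ act Mmod region n lat sig split qData tq t htq0 htq1 ht0
      ht htq)

include ht0 ht htq in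
/-- **The same with the number filled in: `−(ln 7)/5 ≤ −|log Θ|`** at `settingPrVolSharp X75i …` (`deĝ̲(P_q) = (ln 7)/5`,
`ndeg_qPilot_X75i`). [cite: DupuyHilado2025, §3.3, §3.4] [claim: Mochizuki2012, status: disputed] -/
theorem thetaSide_settingPrVolSharp_concreteDatumSqrtNegOne_explicit :
    (((-(Real.log 7 / 5) : ℝ)) : WithTop ℝ) ≤
      (settingPrVolSharp X75i hlog M archPk archSub Ψ act Mmod region n lat sig split qData tq t htq0 htq1).negLogTheta := by
  rw [← ndeg_qPilot_X75i]
  exact thetaSide_settingPrVolSharp_concreteDatumSqrtNegOne hlog M archPk archSub Ψ act Mmod region n lat sig split qData tq t htq0 htq1 ht0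
    ht htq

end Summit.ABC.IUTFork.Thm311.Real

/-! ## §5. Packaged non-vacuity: realising ideles EXIST at `X75i`, and for them the licence and the typed Statement hold -/

namespace Summit.ABC.IUTFork.Thm311.Real

open Set Metric Function NumberField IsDedekindDomain
open Cor312 Cor312.Setting Cor312Vol Literature.IUT.LogThetaLattice Literature.IUT.LogVolume
open Literature.NumberTheory.NumberFields Literature.NumberTheory.GaloisRepresentations.Ultrametric
open Summit.ABC.IUTFork.ConcreteDatumSqrtNegOne

/-- **NON-VACUITY AT THE CONCRETE DATUM, PACKAGED.** With the analytic logarithms `analyticLogv F75i` there EXIST q- and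
Θ-ideles on the completions of `F75i = ℚ(⁵√7, √−1)` that are non-zero, units off `S = V(F75i)₇`, and REALISE `P_q`, `P_Θ` of `X75i`
in Dupuy–Hilado's normalisation (3.4) (abc-iut-c312-3 / `Cor312Prov.exists_realising_{q,theta}Ideles_of_twoMulLDvdOrdq`,
available since `2l = 10 ∣ ord_v(q_v) = 10`), such that for EVERY structural binder of the print-normalised sharp setting
(auxiliary field `M`, archimedean packets, procession data, log-theta-lattice, Frobenioid signature, splitting monoids,
q-pilot data, columns) the (xi-f) `Licence` holds at `settingPrVolSharp X75i …`, the typed `Statement` of Cor. 3.12 holds there,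
AND branch C's antecedent «`∃ ρ qK, QPinned ∧ PilotKummerCompatHull`» is inhabited there. [cite: DupuyHilado2025, §3.3, §3.4, §3.9, §4.9]
[cite: Mochizuki2012, IUTchI Ex. 3.2 (iv) p. 71] [claim: Mochizuki2012, status: disputed] -/
theorem exists_realising_ideles_licence_concreteDatumSqrtNegOne :
    ∃ (tq : ∀ (pp : Nat.Primes) (x : (thetaIndex X75i).Fibre (.inr pp)), haveI : Fact (pp : ℕ).Prime := ⟨pp.2⟩; kOf X75i pp.1 x)
      (t : ∀ (pp : Nat.Primes) (_ : Fin X75i.lstar) (x : (thetaIndex X75i).Fibre (.inr pp)),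
        haveI : Fact (pp : ℕ).Prime := ⟨pp.2⟩; kOf X75i pp.1 x)
      (htq0 : ∀ pp x, tq pp x ≠ 0)
      (htq1 : ∀ (pp : Nat.Primes) (x : (thetaIndex X75i).Fibre (.inr pp)),
        haveI : Fact (pp : ℕ).Prime := ⟨pp.2⟩; placeOf X75i pp.1 x ∉ X75i.S → ‖tq pp x‖ = 1),
      (∀ pp i x, t pp i x ≠ 0) ∧
      (∀ (pp : Nat.Primes) (i : Fin X75i.lstar) (x : (thetaIndex X75i).Fibre (.inr pp)),
          haveI : Fact (pp : ℕ).Prime := ⟨pp.2⟩; placeOf X75i pp.1 x ∉ X75i.S → ‖t pp i x‖ = 1) ∧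
      (∀ (pp : Nat.Primes) (i : Fin X75i.lstar) (x : (thetaIndex X75i).Fibre (.inr pp)),
          haveI : Fact (pp : ℕ).Prime := ⟨pp.2⟩
          Real.log ‖t pp i x‖ = -(X75i.thetaPilot i (placeOf X75i pp.1 x)) * logNorm ↥F75i (placeOf X75i pp.1 x) /
            localDegree ↥F75i (placeOf X75i pp.1 x)) ∧
      (∀ (pp : Nat.Primes) (x : (thetaIndex X75i).Fibre (.inr pp)),
          haveI : Fact (pp : ℕ).Prime := ⟨pp.2⟩
          Real.log ‖tq pp x‖ = -(X75i.qPilot (placeOf X75i pp.1 x)) * logNorm ↥F75i (placeOf X75i pp.1 x) /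
            localDegree ↥F75i (placeOf X75i pp.1 x)) ∧
      ∀ (M : Type) [Field M] [NumberField M]
        (archPk : ∀ (j : (thetaIndex X75i).Label) (vQ : (thetaIndex X75i).VQ),
          Set ((logShellsDH X75i (analyticLogv ↥F75i)).Packet j vQ))
        (archSub : ∀ (j : (thetaIndex X75i).Label) (v : (thetaIndex X75i).V),
          Set ((logShellsDH X75i (analyticLogv ↥F75i)).Packet j ((thetaIndex X75i).over v)))
        (Ψ : ℤ → ∀ v : (thetaIndex X75i).V, v ∈ (thetaIndex X75i).Vbad →
          Set ((logShellsDH X75i (analyticLogv ↥F75i)).StarPacket v))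
        (act : ℤ → ∀ v : (thetaIndex X75i).V, v ∈ (thetaIndex X75i).Vbad →
          (logShellsDH X75i (analyticLogv ↥F75i)).StarPacket v →
            Module.End ℚ ((logShellsDH X75i (analyticLogv ↥F75i)).StarPacket v))
        (Mmod : ℤ → ∀ j : (thetaIndex X75i).LabelStar, Set ((logShellsDH X75i (analyticLogv ↥F75i)).GlobalPacket j.1))
        (region : ℤ → ∀ j : (thetaIndex X75i).LabelStar, FinDivisor M → ∀ vQ : (thetaIndex X75i).VQ,
          Set ((logShellsDH X75i (analyticLogv ↥F75i)).Packet j.1 vQ))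
        (n : ℤ) (HT : Type) (LogLink : HT → HT → Type) (IsFull : ∀ {s t : HT}, LogLink s t → Prop)
        (lat : LGPGaussianLogThetaLattice LogLink IsFull)
        (Frd : Type) (IsoF : Frd → Frd → Type) (Ob : Frd → Type) (realify : Frd → Frd) (Strip : Type)
        (IsoS : Strip → Strip → Type) (Mv : ∀ v : (thetaIndex X75i).V, v ∈ (thetaIndex X75i).Vbad → Type)
        (_ : ∀ v h, Monoid (Mv v h))
        (sig : GlobalLGPFrobenioidSignature (thetaIndex X75i).lstar (thetaIndex X75i).V (· ∈ (thetaIndex X75i).Vbad)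
          Frd IsoF Ob realify Strip IsoS Mv)
        (split : SplittingMonoids Mv) (ObΔ : Type) (N : ∀ v : (thetaIndex X75i).V, v ∈ (thetaIndex X75i).Vbad → Type)
        (_ : ∀ v h, Monoid (N v h)) (qData : QPilotData ObΔ N)
        (col : ℤ → Column (logShellsDH X75i (analyticLogv ↥F75i))),
        Thm311ToCor312.Licence (settingPrVolSharp X75i (logvAnalytic_analyticLogv (F := ↥F75i)) M archPk archSub Ψ act Mmod
            region n lat sig split qData tq t htq0 htq1) ∧
        (settingPrVolSharp X75i (logvAnalytic_analyticLogv (F := ↥F75i)) M archPk archSub Ψ act Mmod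
            region n lat sig split qData tq t htq0 htq1).Statement ∧
        ∃ (ρ : (∀ v : (thetaIndex X75i).V, v ∈ (thetaIndex X75i).Vbad →
                Set ((logShellsDH X75i (analyticLogv ↥F75i)).StarPacket v)) →
              ∀ (j : (thetaIndex X75i).Label) (vQ : (thetaIndex X75i).VQ),
                Set ((logShellsDH X75i (analyticLogv ↥F75i)).Packet j vQ))
          (qK : ∀ v : (thetaIndex X75i).V, v ∈ (thetaIndex X75i).Vbad →
            Set ((logShellsDH X75i (analyticLogv ↥F75i)).StarPacket v)),
          QPinned ({ toSituation := (situationPrVol X75i (logvAnalytic_analyticLogv (F := ↥F75i)) M archPk archSub Ψ act Mmod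
                region), col := col } : LatticeSituation (thetaIndex X75i))
            (settingPrVolSharp X75i (logvAnalytic_analyticLogv (F := ↥F75i)) M archPk archSub Ψ act Mmod region n lat sig split
              qData tq t htq0 htq1) ρ qK ∧
          PilotKummerCompatHull ({ toSituation := (situationPrVol X75i (logvAnalytic_analyticLogv (F := ↥F75i)) M archPk archSub
                Ψ act Mmod region), col := col } : LatticeSituation (thetaIndex X75i))
            (settingPrVolSharp X75i (logvAnalytic_analyticLogv (F := ↥F75i)) M archPk archSub Ψ act Mmod region n lat sig split
              qData tq t htq0 htq1) ρ qK := by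
  obtain ⟨tq, htq0, htq1, htq⟩ := Cor312Prov.exists_realising_qIdeles_of_twoMulLDvdOrdq X75i twoMulLDvdOrdq_X75i
  obtain ⟨t, ht0, ht1, ht⟩ := Cor312Prov.exists_realising_thetaIdeles_of_twoMulLDvdOrdq X75i twoMulLDvdOrdq_X75i
  refine ⟨tq, t, htq0, htq1, ht0, ht1, ht, htq, ?_⟩
  intro M _ _ archPk archSub Ψ act Mmod region n HT LogLink IsFull lat Frd IsoF Ob realify Strip IsoS Mv _ sig split ObΔ N _
    qData col
  exact ⟨licence_settingPrVolSharp_concreteDatumSqrtNegOne (logvAnalytic_analyticLogv (F := ↥F75i)) M archPk archSub Ψ act Mmod region n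
      lat sig split qData tq t htq0 htq1 ht0 ht htq,
    statement_settingPrVolSharp_concreteDatumSqrtNegOne (logvAnalytic_analyticLogv (F := ↥F75i)) M archPk archSub Ψ act Mmod region n
      lat sig split qData tq t htq0 htq1 ht0 ht htq,
    exists_qPinned_and_hull_settingPrVolSharp_concreteDatumSqrtNegOne (logvAnalytic_analyticLogv (F := ↥F75i)) M archPk archSub Ψ act Mmod
      region n lat sig split qData tq t htq0 htq1 col ht0 ht htq⟩

end Summit.ABC.IUTFork.Thm311.Real

end
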